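import Mathlib.RingTheory.PowerSeries.Basic
import Mathlib.Analysis.Normed.Ring.InfiniteSum
import Mathlib.Analysis.Normed.Field.Basic
import Mathlib.Analysis.Normed.Group.InfiniteSum
import HarnessLib

/-!
# Evaluating formal `q`-series with coefficients in any ring `R` along a hom `R →+* 𝕜`
# (the rings `ℚ(u)⟦q⟧`, `ℚ(u₁,u₂)⟦q⟧` of Silverman ATAEC V §3, proof of Thm. V.3.1 (c))

Topic `Literature/NumberTheory/EllipticCurves/TateCurve`, namespace
`Literature.NumberTheory.EllipticCurves.TateCurve.PowerSeriesEval` (abc-iut cell, TRANCHE-T1 P21;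
infrastructure for sub-lemma U-5 — the homomorphism property of Tate's `φ`, whose transfer
argument (ATAEC PDF p. 398) runs in the TWO-variable ring `ℚ(u₁,u₂)⟦q⟧`).

This is the coefficient-generic form of `TateCurve/LaurentSeriesEval.lean` (which is the case
`R = ℤ[u,u⁻¹]`, `f = evCoeff u`): for `Φ ∈ R⟦q⟧`, a ring hom `f : R →+* 𝕜` into a complete normed
field and `q ∈ 𝕜`, `term f Φ q d = f(coeff_d Φ) q^d`, `Conv f Φ q` = absolute convergence,
`ev f Φ q = Σ_d term`. `ev` is additive and multiplicative on absolutely convergent series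
(Cauchy product), `Conv` is closed under ring operations. With `R = ℤ[u₂,u₂⁻¹][u₁,u₁⁻¹]` and
`f` = evaluation at two units this is the evaluation of `ℤ[u₁^{±1},u₂^{±1}]⟦q⟧` needed for the
addition-law identities.

## References
* [SilvermanATAEC1994] J. H. Silverman, *Advanced Topics in the Arithmetic of Elliptic Curves*,
  GTM 151, Springer 1994, proof of Thm. V.3.1 (c) (PDF pp. 397–398).
-/

noncomputable section

open PowerSeries Finset

namespace Literature.NumberTheory.EllipticCurves.TateCurve.PowerSeriesEval

variable {R : Type*} [CommRing R] {𝕜 : Type*} [NormedField 𝕜] (f : R →+* 𝕜) (q : 𝕜)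

/-- The `d`-th term `f(c_d) q^d` of the evaluation of `Φ = Σ c_d q^d` along `f`.
[cite: SilvermanATAEC1994, Thm. V.3.1 (c) (proof, PDF pp. 397–398)] -/
def term (Φ : PowerSeries R) (d : ℕ) : 𝕜 := f (coeff d Φ) * q ^ d

/-- Absolute convergence of the evaluation of `Φ` along `f` at `q`.
[cite: SilvermanATAEC1994, Thm. V.3.1 (c) (proof, PDF pp. 397–398)] -/
def Conv (Φ : PowerSeries R) : Prop := Summable fun d ↦ ‖term f q Φ d‖

/-- The evaluation `ev f q Φ = Σ_d f(c_d) q^d` (junk `0` if not summable).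
[cite: SilvermanATAEC1994, Thm. V.3.1 (c) (proof, PDF pp. 397–398)] -/
def ev (Φ : PowerSeries R) : 𝕜 := ∑' d, term f q Φ d

/-- Terms are additive. [cite: SilvermanATAEC1994, Thm. V.3.1 (c) (proof, PDF pp. 397–398)] -/
theorem term_add (Φ Ψ : PowerSeries R) (d : ℕ) :
    term f q (Φ + Ψ) d = term f q Φ d + term f q Ψ d := by
  simp [term, map_add, add_mul]

/-- Terms of a negation. [cite: SilvermanATAEC1994, Thm. V.3.1 (c) (proof, PDF pp. 397–398)] -/
theorem term_neg (Φ : PowerSeries R) (d : ℕ) : term f q (-Φ) d = -term f q Φ d := by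
  simp [term, map_neg]

/-- Terms of a product (Cauchy product). [cite: SilvermanATAEC1994, Thm. V.3.1 (c) (proof, PDF pp. 397–398)] -/
theorem term_mul (Φ Ψ : PowerSeries R) (d : ℕ) :
    term f q (Φ * Ψ) d = ∑ ij ∈ antidiagonal d, term f q Φ ij.1 * term f q Ψ ij.2 := by
  rw [term, coeff_mul, map_sum, sum_mul]
  refine sum_congr rfl fun ij hij ↦ ?_
  rw [mem_antidiagonal] at hij
  rw [map_mul, term, term, ← hij, pow_add]
  ring

/-- Terms of a constant. [cite: SilvermanATAEC1994, Thm. V.3.1 (c) (proof, PDF pp. 397–398)] -/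
theorem term_C (c : R) (d : ℕ) :
    term f q (PowerSeries.C c) d = if d = 0 then f c else 0 := by
  rw [term, coeff_C]
  split_ifs with h
  · simp [h]
  · simp

/-- `Conv` is preserved by addition. [cite: SilvermanATAEC1994, Thm. V.3.1 (c) (proof, PDF pp. 397–398)] -/
theorem Conv.add {Φ Ψ : PowerSeries R} (hΦ : Conv f q Φ) (hΨ : Conv f q Ψ) : Conv f q (Φ + Ψ) := by
  refine Summable.of_nonneg_of_le (fun _ ↦ norm_nonneg _) (fun d ↦ ?_) (Summable.add hΦ hΨ)
  rw [term_add]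
  exact norm_add_le _ _

/-- `Conv` is preserved by negation. [cite: SilvermanATAEC1994, Thm. V.3.1 (c) (proof, PDF pp. 397–398)] -/
theorem Conv.neg {Φ : PowerSeries R} (hΦ : Conv f q Φ) : Conv f q (-Φ) := by
  refine Summable.congr hΦ fun d ↦ ?_
  rw [term_neg, norm_neg]

/-- `Conv` is preserved by subtraction. [cite: SilvermanATAEC1994, Thm. V.3.1 (c) (proof, PDF pp. 397–398)] -/
theorem Conv.sub {Φ Ψ : PowerSeries R} (hΦ : Conv f q Φ) (hΨ : Conv f q Ψ) : Conv f q (Φ - Ψ) := by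
  rw [sub_eq_add_neg]; exact hΦ.add f q (hΨ.neg f q)

/-- `Conv` is preserved by products. [cite: SilvermanATAEC1994, Thm. V.3.1 (c) (proof, PDF pp. 397–398)] -/
theorem Conv.mul [CompleteSpace 𝕜] {Φ Ψ : PowerSeries R} (hΦ : Conv f q Φ) (hΨ : Conv f q Ψ) :
    Conv f q (Φ * Ψ) := by
  have h := summable_norm_sum_mul_antidiagonal_of_summable_norm hΦ hΨ
  refine h.congr fun d ↦ ?_
  rw [term_mul]

/-- Constants are `Conv`. [cite: SilvermanATAEC1994, Thm. V.3.1 (c) (proof, PDF pp. 397–398)] -/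
theorem Conv.C (c : R) : Conv f q (PowerSeries.C c) := by
  refine summable_of_ne_finset_zero (s := {0}) fun d hd ↦ ?_
  rw [Finset.mem_singleton] at hd
  rw [term_C, if_neg hd, norm_zero]

/-- Powers are `Conv`. [cite: SilvermanATAEC1994, Thm. V.3.1 (c) (proof, PDF pp. 397–398)] -/
theorem Conv.pow [CompleteSpace 𝕜] {Φ : PowerSeries R} (hΦ : Conv f q Φ) :
    ∀ n : ℕ, Conv f q (Φ ^ n)
  | 0 => by rw [pow_zero, ← map_one PowerSeries.C]; exact Conv.C f q 1
  | n + 1 => by rw [pow_succ]; exact (Conv.pow hΦ n).mul f q hΦ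

/-- `ev` is additive on summable series. [cite: SilvermanATAEC1994, Thm. V.3.1 (c) (proof, PDF pp. 397–398)] -/
theorem ev_add [CompleteSpace 𝕜] {Φ Ψ : PowerSeries R} (hΦ : Conv f q Φ) (hΨ : Conv f q Ψ) :
    ev f q (Φ + Ψ) = ev f q Φ + ev f q Ψ := by
  rw [ev, ev, ev, ← (Summable.of_norm hΦ).tsum_add (Summable.of_norm hΨ)]
  exact tsum_congr fun d ↦ term_add f q Φ Ψ d

/-- `ev` of a negation. [cite: SilvermanATAEC1994, Thm. V.3.1 (c) (proof, PDF pp. 397–398)] -/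
theorem ev_neg (Φ : PowerSeries R) : ev f q (-Φ) = -ev f q Φ := by
  rw [ev, ev, ← tsum_neg]
  exact tsum_congr fun d ↦ term_neg f q Φ d

/-- `ev` of a difference. [cite: SilvermanATAEC1994, Thm. V.3.1 (c) (proof, PDF pp. 397–398)] -/
theorem ev_sub [CompleteSpace 𝕜] {Φ Ψ : PowerSeries R} (hΦ : Conv f q Φ) (hΨ : Conv f q Ψ) :
    ev f q (Φ - Ψ) = ev f q Φ - ev f q Ψ := by
  rw [sub_eq_add_neg, ev_add f q hΦ (hΨ.neg f q), ev_neg, ← sub_eq_add_neg]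

/-- **`ev` is multiplicative on absolutely convergent series** (Cauchy product).
[cite: SilvermanATAEC1994, Thm. V.3.1 (c) (proof, PDF pp. 397–398)] -/
theorem ev_mul [CompleteSpace 𝕜] {Φ Ψ : PowerSeries R} (hΦ : Conv f q Φ) (hΨ : Conv f q Ψ) :
    ev f q (Φ * Ψ) = ev f q Φ * ev f q Ψ := by
  rw [ev, ev, ev, tsum_mul_tsum_eq_tsum_sum_antidiagonal_of_summable_norm hΦ hΨ]
  exact tsum_congr fun d ↦ term_mul f q Φ Ψ d

/-- `ev` of a constant. [cite: SilvermanATAEC1994, Thm. V.3.1 (c) (proof, PDF pp. 397–398)] -/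
theorem ev_C (c : R) : ev f q (PowerSeries.C c) = f c := by
  rw [ev, tsum_eq_single 0 fun d hd ↦ by rw [term_C, if_neg hd], term_C, if_pos rfl]

/-- `ev` of a power. [cite: SilvermanATAEC1994, Thm. V.3.1 (c) (proof, PDF pp. 397–398)] -/
theorem ev_pow [CompleteSpace 𝕜] {Φ : PowerSeries R} (hΦ : Conv f q Φ) :
    ∀ n : ℕ, ev f q (Φ ^ n) = ev f q Φ ^ n
  | 0 => by rw [pow_zero, pow_zero, ← map_one PowerSeries.C, ev_C, map_one]
  | n + 1 => by rw [pow_succ, pow_succ, ev_mul f q (hΦ.pow f q n) hΦ, ev_pow hΦ n]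

/-- `ev (C c * Φ) = f c · ev Φ`. [cite: SilvermanATAEC1994, Thm. V.3.1 (c) (proof, PDF pp. 397–398)] -/
theorem ev_C_mul (c : R) (Φ : PowerSeries R) : ev f q (PowerSeries.C c * Φ) = f c * ev f q Φ := by
  rw [ev, ev, ← tsum_mul_left]
  refine tsum_congr fun d ↦ ?_
  rw [term, term, coeff_C_mul, map_mul, mul_assoc]

/-- `Conv (C c * Φ)` from `Conv Φ`. [cite: SilvermanATAEC1994, Thm. V.3.1 (c) (proof, PDF pp. 397–398)] -/
theorem Conv.C_mul {Φ : PowerSeries R} (hΦ : Conv f q Φ) (c : R) : Conv f q (PowerSeries.C c * Φ) := by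
  have h := Summable.mul_left ‖f c‖ hΦ
  refine Summable.of_nonneg_of_le (fun _ ↦ norm_nonneg _) (fun d ↦ ?_) h
  rw [term, coeff_C_mul, map_mul, mul_assoc, norm_mul]
  rfl

/-- The evaluation as a `HasSum` statement. [cite: SilvermanATAEC1994, Thm. V.3.1 (c) (proof, PDF pp. 397–398)] -/
theorem hasSum_term [CompleteSpace 𝕜] {Φ : PowerSeries R} (hΦ : Conv f q Φ) :
    HasSum (term f q Φ) (ev f q Φ) :=
  (Summable.of_norm hΦ).hasSum

/-- Functoriality in the coefficient hom: `term (f ∘ g) Φ = term f (map g Φ)`.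
[cite: SilvermanATAEC1994, Thm. V.3.1 (c) (proof, PDF pp. 397–398)] -/
theorem term_map {S : Type*} [CommRing S] (g : S →+* R) (Φ : PowerSeries S) (d : ℕ) :
    term f q (PowerSeries.map g Φ) d = term (f.comp g) q Φ d := by
  rw [term, term, coeff_map, RingHom.comp_apply]

/-- `ev f (map g Φ) = ev (f ∘ g) Φ`. [cite: SilvermanATAEC1994, Thm. V.3.1 (c) (proof, PDF pp. 397–398)] -/
theorem ev_map {S : Type*} [CommRing S] (g : S →+* R) (Φ : PowerSeries S) :
    ev f q (PowerSeries.map g Φ) = ev (f.comp g) q Φ := by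
  rw [ev, ev]; exact tsum_congr fun d ↦ term_map f q g Φ d

end Literature.NumberTheory.EllipticCurves.TateCurve.PowerSeriesEval

end
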